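/-
Copyright (c) 2026 the pub-hodgecm-mathlib formalisation cell (harness21).  Prover seat hodgecm-mathlib-K2E3-p24 (g2), HCML Track B «K2-LIT» ∕ h413 (`stmt-HodgeConjecture-24833`),
line «SC′-IRR-lev» (lead K2E3-p24, dealer D82): ASM CORE of the leaf (S-C′-irr) `sig_K2E3GL3TwoBlockInducedIrreducible` — `ρ × χ` irreducible, hypothesis-first on `r_{Q'}`.  2026-09-04.
-/
import Summits.HodgeConjecture.HodgeConjecture.Theorems.K2E3GL3CuspidalBlockJacquetBorel      -- JM-A (this seat): `r_Q(i_Q σ') ≅ σ'` irreducible, `r_B(i_Q σ') = 0`; brings K0, parts 1–2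
import Summits.HodgeConjecture.HodgeConjecture.Theorems.K2E3GL3CuspidalBlockRestriction      -- ★ BLK (K2E3-p21): `W = W(X₁₀) = W(X₀₁)`, `δ|_{U} = 1`, Levi irreducibility letters
import Summits.HodgeConjecture.HodgeConjecture.Theorems.K2E3GL3DegenerateJacquetVanishing     -- ★ DEG (K2E3-p23): a degenerate irreducible has both maximal Jacquet modules ≠ 0 (over ★ LEV-3, K2E3-p17)
import Summits.HodgeConjecture.HodgeConjecture.Theorems.K2E3GenericConstituentCount           -- ★ GEN-COUNT (K2E3-p24 g0): two generic layers need two Whittaker functionals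
import Literature.NumberTheory.Automorphic.JacquetFiniteLengthCriterion                       -- ★ `jacquetImage`, `exists_jacquetImage_lt` (the counting argument), cyclic quotients
import Literature.NumberTheory.Automorphic.ParabolicIndGLNoSupercuspidalSubquotient           -- ★ CUSP (Casselman 5.4.3 for `GL_n`)
import Literature.NumberTheory.Automorphic.ParabolicGLProofs                                  -- ★ `isAdmissible_parabolicIndGL_holds`
import Literature.NumberTheory.Automorphic.MatrixCoefficientsSupercuspidalAdmissibleProofs    -- ★ `IsSupercuspidal.isAdmissible_of_sigmaCompactSpace`
import Literature.NumberTheory.Automorphic.PAdicRepsJacquetAdmissibilityProofs                -- ★ `sigmaCompactSpace_levi`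
import Literature.RepresentationTheory.Semisimple.SubrepresentationEquiv                      -- ★ `Subrepresentation.subtypeIntertwiningMap_injective`
import Summits.HodgeConjecture.HodgeConjecture.Theorems.K2E3TwoBlockCuspidalSupportEmbedding     -- ★ (K2E3-p24 g0) `eq_id_of_monotone_surjective`
import HarnessLib

/-!
# K2_E3 road (h413), line «SC′-IRR-lev», ASM CORE — LEAF (S-C′-irr): for `σ` irreducible smooth supercuspidal on a maximal Levi of `GL₃(F)`, `i_{P_c} σ` is IRREDUCIBLE
# ([Zelevinsky1980, Thm. 4.2]: `ρ × χ` and `χ × ρ` are irreducible — one-element segments on different cuspidal lines are never linked)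

Cell `pub/hodgecm-mathlib` (D-0151), Track B, seat K2E3-p24 (g2) = LEAD of line «SC′-IRR-lev» (dealer K2E3-plan D82; hands BLK K2E3-p21 (g6) D83, JM-B K2E5-p17 (g6) D84,
DEG K2E3-p23 (g6) D85, T1 K2E3-p21 (g6) D81, LEV-3 K2E3-p17 (g8) D76).  `--supports stmt-HodgeConjecture-24833 --as helper`; THEOREMS ONLY (no definition ∕ instance ∕ notation ∕
named fact ∕ `sorry`); never imports `Cruxes/…/Lines`.  COUNT-NEUTRAL.

THE MATHEMATICS (Bernstein–Zelevinsky's proof of the irreducibility criterion [BernsteinZelevinsky1977, Thm. 4.2 ∕ §2.12–2.14, §4.7] and [Zelevinsky1980, Thm. 4.2 p. 184],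
specialised to `GL₃ ⊃ P = P₍₂,₁₎ ⊃ M ≅ GL₂ × GL₁`, WITHOUT derivatives).  `σ` irreducible smooth supercuspidal on `M`, `σ' = (σ ∘ proj) ⊗ δ^{1∕2}`, `π = i_Q σ = Ind_P σ'`
(admissible, smooth), `Q' = P₍₁,₂₎`, `B` the Borel.  Jacquet modules of `π` (all ★): `r_Q(π) ≅ σ'` IRREDUCIBLE (JM-A `isIrreducible_jacquetGL_twoOne`, over ★ BLK
`W = W(X₁₀)`), `r_{Q'}(π)` IRREDUCIBLE (JM-B `isIrreducible_jacquetGL_oneTwo`, over `W = W(X₀₁)`), `r_B(π) = 0` (JM-A part 3).  For a subrepresentation `V ≤ π` put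
`Φ_c(V) :=` image of `V` in `r_c(π)` (★ `jacquetImage`); so `Φ_Q(V), Φ_{Q'}(V) ∈ {⊥, ⊤}` and `Φ_B ≡ ⊥`.  By Bernstein–Zelevinsky's separation lemma (★ `exists_jacquetImage_lt`,
which packages Harish-Chandra's criterion ★ and Casselman's «no supercuspidal subquotient» ★ CUSP for `i_Q σ`), a STRICT inclusion of subrepresentations is seen by some
proper `Φ_c`.  Hence if `⊥ < V < ⊤` then `(Φ_Q V, Φ_{Q'} V) ∈ {(⊤,⊥), (⊥,⊤)}` — the «half constituent».  By Rodier ∕ local multiplicity one (★ WH-1 `dim Wh_ψ(π) ≤ 1`) and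
left exactness of `J_ψ` (★ GEN-COUNT) one of the layers `V`, `π ∕ V` is `ψ`-DEGENERATE; that layer `τ` is non-zero, smooth, degenerate, and has `r_Q(τ) = 0` or `r_{Q'}(τ) = 0`
(`Φ = ⊥` on a sub by left exactness ★ `mem_coinvariantsKer_toRepresentation`, `Φ = ⊤` on the quotient).  The cyclic subrepresentation of a non-zero vector of `τ` has an
irreducible quotient `ω` (★ `exists_isCoatom_subrepresentation`) which is smooth, degenerate (★ `isGeneric_of_injective`∕`_of_surjective`) and has the same vanishing Jacquet
module — contradicting ★ DEG (`false_of_degenerate_of_subsingleton_coinvariants`: by ★ LEV-3 a `ψ`-degenerate irreducible with `r_Q = 0` or `r_{Q'} = 0` would have `U₃`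
acting trivially).  So `π` is irreducible for `c = ![0,0,1]`; `c = ![0,1,1]` follows by ★ T1 (`g ↦ w₀ ᵗg⁻¹ w₀`), and a monotone surjective `c : Fin 3 → Fin 2` is one of the two.

* §1 `eq_twoOne_or_eq_oneTwo` — the proper two-block labellings of `GL₃` (the Borel one is `id`, ★ g0 `eq_id_of_monotone_surjective`).
* §2 `ker_toRepresentation_eq_top_of_jacquetImage_eq_bot`, `ker_quotientRep_eq_top_of_jacquetImage_eq_top` — `Φ_c(V) = ⊥ ⇒ r_c(V) = 0`, `Φ_c(V) = ⊤ ⇒ r_c(π∕V) = 0`.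
* §3 `false_of_not_isGeneric_of_ker_eq_top` — a non-zero smooth DEGENERATE representation of `GL₃(F)` with `r_Q = 0` or `r_{Q'} = 0` does not exist (cyclic quotient + ★ DEG).
* §4 **`isIrreducible_parabolicIndGL_twoOne_of_jacquet`** — `ρ × χ` irreducible, HYPOTHESIS-FIRST on the `Q'`-letter `hJ₁ : (jacquetGL F ![0,1,1] (i_Q σ)).IsIrreducible`
  (= JM-B `isIrreducible_jacquetGL_oneTwo`, K2E5-p17) and on `hrank : dim Wh_ψ(i_Q σ) ≤ 1` (★ WH-1); the sequel `K2E3GL3TwoBlockInducedIrreducible` pays both, adds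
  `c = ![0,1,1]` by ★ T1, and states the leaf VERBATIM.

HONEST LABEL: HC_CM is proved only modulo the 7 printed citations (2 remaining named inputs: hLiu418 = stmt-HodgeConjecture-24832, h413 = stmt-HodgeConjecture-24833)
until rung 0 closes; count-neutral helper.

## Mathlib ∕ tree search
Tree (★, by name): `jacquetImage`, `mem_jacquetImage_iff`, `jacquetImage_mono`, `exists_jacquetImage_lt`, `mem_coinvariantsKer_toRepresentation`, `map_coinvariantsKer_le`,
`span_orbit_mkQ_eq_top`, `Subrepresentation.{quotientRep, mkQ, mkQ_surjective, mkQ_eq_zero_iff, isIrreducible_quotientRep, subtypeIntertwiningMap}`, `Representation.orbitSpan`,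
`exists_isCoatom_subrepresentation`, `finite_asModule_of_span_orbit_eq_top`, `IsSmooth.{toRepresentation, quotientRep, twist_comp_leviProjection}`, `isSmooth_smoothInd`,
`isAdmissible_parabolicIndGL_holds`, `IsSupercuspidal.isAdmissible_of_sigmaCompactSpace`, `sigmaCompactSpace_levi`, `intertwiningMap_subrepresentation_parabolicIndGL_eq_zero_of_isIrreducible`,
`rank_whittakerFunctionals_parabolicIndGL_le_one_of_fact`, `rank_whittakerFunctionals_le_one_holds`, `two_layers_not_generic_of_rank_le_one`, `isGeneric_of_injective`, `isGeneric_of_surjective`,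
`exists_addChar_isContinuousNontrivial`, JM-A `isIrreducible_jacquetGL_twoOne`, `subsingleton_coinvariants_restrictUnipotentGL_id`, BLK letters, DEG, T1
`isIrreducible_parabolicIndGL_one_two_of_two_one`.  Dedup: `rg "TwoBlockInducedIrreducible|twoBlockInducedIrreducible"` — only the U12 `sig_` and g0's consumer F3∕F4 (hypothesis `hIrr`).

## References
* [Zelevinsky1980] A. V. Zelevinsky, *Induced representations of reductive 𝔭-adic groups II*, Ann. Sci. ÉNS (4) 13 (1980), 165–210, Thm. 4.2 p. 184, 4.3.
* [BernsteinZelevinsky1977] I. N. Bernstein, A. V. Zelevinsky, *Induced representations of reductive 𝔭-adic groups I*, Ann. Sci. ÉNS 10 (1977), Prop. 1.9, 2.12–2.14, Thm. 4.2, §4.7.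
* [Casselman1995] W. Casselman, *Introduction to the theory of admissible representations of 𝔭-adic reductive groups* (1995), Cor. 5.4.3, §6.3, Cor. 6.3.7.
-/

set_option autoImplicit false
set_option linter.dupNamespace false

noncomputable section

open Matrix

namespace Summit.HodgeConjecture.HodgeConjecture.Cruxes.H413.K2E3GL3TwoBlockInducedIrreducibleCore

open Literature.NumberTheory.Automorphic Representation K2E3GL3MaximalParabolicRelabel

universe u

/-! ## §1  The proper block labellings of `GL₃` -/

section Labels

/-- A monotone surjective `c : Fin 3 → Fin 2` is `![0,0,1]` (`P₍₂,₁₎`) or `![0,1,1]` (`P₍₁,₂₎`). [cite: BernsteinZelevinsky1977, §2.2] -/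
theorem eq_twoOne_or_eq_oneTwo (c : Fin 3 → Fin 2) (hc : Monotone c) (hcs : Function.Surjective c) :
    c = (![0, 0, 1] : Fin 3 → Fin 2) ∨ c = (![0, 1, 1] : Fin 3 → Fin 2) := by
  have h0 : c 0 = 0 := by
    obtain ⟨i, hi⟩ := hcs 0
    exact le_antisymm (hi ▸ hc (Fin.zero_le i)) (Fin.zero_le _)
  have h2 : c 2 = 1 := by
    obtain ⟨i, hi⟩ := hcs 1
    refine le_antisymm (Fin.le_last _) ?_
    exact hi ▸ hc (Fin.le_last i)
  rcases Fin.exists_fin_two.1 ⟨c 1, rfl⟩ with h1 | h1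
  · left; funext i; fin_cases i <;> simp [h0, h1, h2]
  · right; funext i; fin_cases i <;> simp [h0, h1, h2]

end Labels

/-! ## §2  `Φ_c(V)`: vanishing Jacquet modules of a layer from its image in `r_c(π)` -/

section JacquetImage

variable {F : Type*} [Field F] [ValuativeRel F] [TopologicalSpace F] [IsNonarchimedeanLocalField F]
  {r : ℕ} (c : Fin 3 → Fin r) {X : Type*} [AddCommGroup X] [Module ℂ X] {I : Representation ℂ (GL (Fin 3) F) X}

/-- **`Φ_c(V) = ⊥ ⇒ r_c(V) = 0`** (left exactness of `r_c`, ★ `mem_coinvariantsKer_toRepresentation`): if the image of the subrepresentation `V` in `r_c(π)` is zero, every vector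
of `V` dies in `V`'s own `U_c`-coinvariants. [cite: BernsteinZelevinsky1977, Prop. 1.9 (a)] -/
theorem ker_toRepresentation_eq_top_of_jacquetImage_eq_bot (hI : I.IsSmooth) (hc : Monotone c) (N : Subrepresentation I) (h : jacquetImage c I N = ⊥) :
    Coinvariants.ker (restrictUnipotentGL F c N.toRepresentation) = ⊤ := by
  refine eq_top_iff.2 fun b _ => mem_coinvariantsKer_toRepresentation c hI hc N ?_
  have hb : Coinvariants.mk (restrictUnipotentGL F c I) (b : X) ∈ jacquetImage c I N := ⟨b, b.2, rfl⟩
  rw [h] at hb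
  exact (Coinvariants.mk_eq_zero _).1 ((Submodule.mem_bot ℂ).1 hb)

omit [ValuativeRel F] [TopologicalSpace F] [IsNonarchimedeanLocalField F] in
/-- **`Φ_c(V) = ⊤ ⇒ r_c(π ∕ V) = 0`** (right exactness): if `V` maps onto `r_c(π)`, every class of `π ∕ V` dies in the `U_c`-coinvariants of `π ∕ V`.
[cite: BernsteinZelevinsky1977, Prop. 1.9 (b)] -/
theorem ker_quotientRep_eq_top_of_jacquetImage_eq_top (N : Subrepresentation I) (h : jacquetImage c I N = ⊤) :
    Coinvariants.ker (restrictUnipotentGL F c N.quotientRep) = ⊤ := by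
  refine eq_top_iff.2 fun x _ => ?_
  obtain ⟨g, rfl⟩ := N.mkQ_surjective x
  have hg : Coinvariants.mk (restrictUnipotentGL F c I) g ∈ jacquetImage c I N := by rw [h]; trivial
  obtain ⟨v, hv, hvg⟩ := (mem_jacquetImage_iff c I N _).1 hg
  have hker : g - v ∈ Coinvariants.ker (restrictUnipotentGL F c I) := by
    rw [← Coinvariants.mk_eq_zero, map_sub, hvg, sub_self]
  have hx : N.mkQ g = N.mkQ (g - v) := by rw [map_sub, (N.mkQ_eq_zero_iff v).2 hv, sub_zero]
  rw [hx]
  exact map_coinvariantsKer_le c I N.mkQ ⟨_, hker, rfl⟩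

omit [ValuativeRel F] [TopologicalSpace F] [IsNonarchimedeanLocalField F] in
/-- If `r_c(π)` is zero, all the images `Φ_c(V)` coincide (with `⊥`). [folklore] -/
theorem jacquetImage_eq_bot_of_subsingleton (hs : Subsingleton (restrictUnipotentGL F c I).Coinvariants) (N : Subrepresentation I) : jacquetImage c I N = ⊥ :=
  le_bot_iff.1 fun x _ => by rw [Subsingleton.elim x 0]; exact Submodule.zero_mem _

end JacquetImage

/-! ## §3  No non-zero smooth degenerate representation of `GL₃(F)` has a vanishing maximal Jacquet module -/

section Degenerate

variable {F : Type*} [Field F] [ValuativeRel F] [TopologicalSpace F] [IsNonarchimedeanLocalField F]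

/-- **A non-zero smooth `ψ`-DEGENERATE representation `τ` of `GL₃(F)` cannot have `r_Q(τ) = 0` or `r_{Q'}(τ) = 0`** (`Q = P₍₂,₁₎`, `Q' = P₍₁,₂₎`).  The cyclic subrepresentation `B`
of a non-zero vector is finitely generated, so has an irreducible quotient `ω` (★ `exists_isCoatom_subrepresentation`, ★ `isIrreducible_quotientRep`); `ω` is smooth,
degenerate (`B ↪ τ` and `B ↠ ω`: ★ `isGeneric_of_injective`, ★ `isGeneric_of_surjective`), and `r_c(ω) = 0` (left exactness on `B ≤ τ`, right exactness on `B ↠ ω`) —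
impossible by ★ DEG. [cite: BernsteinZelevinsky1977, §2.14 (1), Thm. 4.2] [cite: Zelevinsky1980, 4.3] -/
theorem false_of_not_isGeneric_of_ker_eq_top {X : Type*} [AddCommGroup X] [Module ℂ X] [Nontrivial X] (τ : Representation ℂ (GL (Fin 3) F) X) (hτ : τ.IsSmooth)
    {ψ : AddChar F Circle} (hψ : ψ.IsContinuousNontrivial) (hdg : ¬ IsGeneric τ ψ)
    (h : Coinvariants.ker (restrictUnipotentGL F (![0, 0, 1] : Fin 3 → Fin 2) τ) = ⊤ ∨ Coinvariants.ker (restrictUnipotentGL F (![0, 1, 1] : Fin 3 → Fin 2) τ) = ⊤) :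
    False := by
  classical
  obtain ⟨w₀, hw₀⟩ := exists_ne (0 : X)
  -- the cyclic subrepresentation `B = ⟨w₀⟩` presented as `(⊥ ⊔ ⟨w₀⟩) ⧸ ⊥`, to reuse ★ `span_orbit_mkQ_eq_top`
  set B : Subrepresentation τ := ⊥ ⊔ τ.orbitSpan w₀ with hBdef
  have hw₀B : w₀ ∈ B := (le_sup_right : τ.orbitSpan w₀ ≤ B) ⟨Finsupp.single 1 1, by simp⟩
  let NinB : Subrepresentation B.toRepresentation :=
    ⟨(⊥ : Subrepresentation τ).toSubmodule.comap B.toSubmodule.subtype, fun g b hb => (⊥ : Subrepresentation τ).apply_mem_toSubmodule g hb⟩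
  have hNinB : ∀ b : B.toSubmodule, (b : X) ∈ (⊥ : Subrepresentation τ) → b ∈ NinB := fun b hb => hb
  have hBs : B.toRepresentation.IsSmooth := hτ.toRepresentation B
  have hTs : NinB.quotientRep.IsSmooth := hBs.quotientRep NinB
  have hv₀ : NinB.mkQ ⟨w₀, hw₀B⟩ ≠ 0 := fun h0 => hw₀ ((Submodule.mem_bot ℂ).1 ((NinB.mkQ_eq_zero_iff _).1 h0))
  haveI : Module.Finite (MonoidAlgebra ℂ (GL (Fin 3) F)) NinB.quotientRep.asModule :=
    finite_asModule_of_span_orbit_eq_top NinB.quotientRep (Set.finite_singleton (NinB.mkQ ⟨w₀, hw₀B⟩)) (span_orbit_mkQ_eq_top ⊥ w₀ NinB hNinB hw₀B)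
  haveI : Nontrivial (B.toSubmodule ⧸ NinB.toSubmodule) := ⟨⟨NinB.mkQ ⟨w₀, hw₀B⟩, 0, hv₀⟩⟩
  obtain ⟨A, hA⟩ := exists_isCoatom_subrepresentation NinB.quotientRep
  haveI hωirr : A.quotientRep.IsIrreducible := Subrepresentation.isIrreducible_quotientRep hA
  have hωs : A.quotientRep.IsSmooth := hTs.quotientRep A
  -- `ω` is degenerate
  have hωdg : ¬ IsGeneric A.quotientRep ψ := by
    intro hω
    have hT : IsGeneric NinB.quotientRep ψ := K2E3GenericConstituentCount.isGeneric_of_surjective ψ A.mkQ A.mkQ_surjective hω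
    have hB : IsGeneric B.toRepresentation ψ := K2E3GenericConstituentCount.isGeneric_of_surjective ψ NinB.mkQ NinB.mkQ_surjective hT
    exact hdg (K2E3GenericConstituentCount.isGeneric_of_injective ψ hτ hψ.1
      (Literature.RepresentationTheory.FiniteGroups.Subrepresentation.subtypeIntertwiningMap B)
      (Literature.RepresentationTheory.Semisimple.Subrepresentation.subtypeIntertwiningMap_injective B) hB)
  -- `ω` has the same vanishing Jacquet module
  have hωker : ∀ {r : ℕ} (c : Fin 3 → Fin r), Monotone c → Coinvariants.ker (restrictUnipotentGL F c τ) = ⊤ →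
      Subsingleton (restrictUnipotentGL F c A.quotientRep).Coinvariants := by
    intro r c hc hker
    have hkerT : Coinvariants.ker (restrictUnipotentGL F c NinB.quotientRep) = ⊤ := by
      refine eq_top_iff.2 fun x _ => ?_
      obtain ⟨b, rfl⟩ := NinB.mkQ_surjective x
      have hb : (b : X) ∈ Coinvariants.ker (restrictUnipotentGL F c τ) := by rw [hker]; trivial
      exact map_coinvariantsKer_le c (I := B.toRepresentation) NinB.mkQ ⟨_, mem_coinvariantsKer_toRepresentation c hτ hc B hb, rfl⟩
    have hkerω : Coinvariants.ker (restrictUnipotentGL F c A.quotientRep) = ⊤ := by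
      refine eq_top_iff.2 fun x _ => ?_
      obtain ⟨t, rfl⟩ := A.mkQ_surjective x
      have ht : t ∈ Coinvariants.ker (restrictUnipotentGL F c NinB.quotientRep) := by rw [hkerT]; trivial
      exact map_coinvariantsKer_le c (I := NinB.quotientRep) A.mkQ ⟨t, ht, rfl⟩
    refine ⟨fun x y => ?_⟩
    obtain ⟨x, rfl⟩ := Coinvariants.mk_surjective _ x
    obtain ⟨y, rfl⟩ := Coinvariants.mk_surjective _ y
    rw [Coinvariants.mk_eq_iff, hkerω]
    trivial
  rcases h with h | h
  · exact K2E3GL3DegenerateJacquetVanishing.false_of_degenerate_of_subsingleton_coinvariants A.quotientRep hωs hψ hωdg (Or.inl (hωker _ monotone_twoOne h))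
  · exact K2E3GL3DegenerateJacquetVanishing.false_of_degenerate_of_subsingleton_coinvariants A.quotientRep hωs hψ hωdg (Or.inr (hωker _ monotone_oneTwo h))

end Degenerate

/-! ## §4  The assembly -/

section Assembly

variable {F : Type u} [Field F] [ValuativeRel F] [TopologicalSpace F] [IsNonarchimedeanLocalField F]
  {W : Type u} [AddCommGroup W] [Module ℂ W]
  (σ : Representation ℂ (Π a, GL {i // (![0, 0, 1] : Fin 3 → Fin 2) i = a} F) W)

/-- **`ρ × χ` IS IRREDUCIBLE, hypothesis-first on the `Q'`-letter and on Whittaker multiplicity one.**  For `σ` irreducible smooth supercuspidal on the Levi `GL₂(F) × GL₁(F)`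
of `P₍₂,₁₎`: if the Jacquet module `r_{Q'}(i_Q σ)` along the OTHER maximal parabolic `Q' = P₍₁,₂₎` is irreducible (letter `hJ₁` = JM-B `isIrreducible_jacquetGL_oneTwo`) and
`dim Hom_{U₃}(i_Q σ, ψ) ≤ 1` for a continuous non-trivial `ψ` (letter `hrank` = ★ WH-1 `rank_whittakerFunctionals_parabolicIndGL_le_one_of_fact` + ★
`rank_whittakerFunctionals_le_one_holds`), then `i_Q σ` is irreducible.
[cite: Zelevinsky1980, Thm. 4.2 p. 184] [cite: BernsteinZelevinsky1977, Thm. 4.2, §2.12–2.14] -/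
theorem isIrreducible_parabolicIndGL_twoOne_of_jacquet [σ.IsIrreducible] (hσ : σ.IsSmooth) (hsc : σ.IsSupercuspidal)
    {ψ : AddChar F Circle} (hψ : ψ.IsContinuousNontrivial)
    (hrank : Module.rank ℂ ↥(whittakerFunctionals (parabolicIndGL F (![0, 0, 1] : Fin 3 → Fin 2) σ) ψ) ≤ 1)
    (hJ₁ : (jacquetGL F (![0, 1, 1] : Fin 3 → Fin 2) (parabolicIndGL F (![0, 0, 1] : Fin 3 → Fin 2) σ)).IsIrreducible) :
    (parabolicIndGL F (![0, 0, 1] : Fin 3 → Fin 2) σ).IsIrreducible := by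
  classical
  -- admissibility of `σ`, the letters of ★ BLK, smoothness of `σ'` and `π`
  haveI : SigmaCompactSpace (Π a, GL {i // (![0, 0, 1] : Fin 3 → Fin 2) i = a} F) := sigmaCompactSpace_levi F _
  have hadm : σ.IsAdmissible := IsSupercuspidal.isAdmissible_of_sigmaCompactSpace hσ hsc
  haveI : Nontrivial W := IsIrreducible.nontrivial σ
  have hσ's : (Representation.twist (σ.comp (leviProjection F (![0, 0, 1] : Fin 3 → Fin 2))) (rootDeltaChar (standardParabolicGL F (![0, 0, 1] : Fin 3 → Fin 2)))).IsSmooth :=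
    hσ.twist_comp_leviProjection F _
  have hW := K2E3GL3CuspidalBlockRestriction.mem_span_twist_transvection_one_zero_sub F σ hσ hsc
  have hW₀₁ := K2E3GL3CuspidalBlockRestriction.mem_span_twist_transvection_zero_one_sub F σ hσ hsc
  have htriv := K2E3GL3CuspidalBlockRestriction.twist_leviProjection_apply_eq_self_of_mem_unipotentRadicalP F σ
  have hirr := K2E3GL3CuspidalBlockRestriction.forall_submodule_eq_bot_or_top_of_leviStable F σ
  have hπs : (parabolicIndGL F (![0, 0, 1] : Fin 3 → Fin 2) σ).IsSmooth := isSmooth_smoothInd _ _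
  -- the three Jacquet modules of `π`
  have hJ₀ : (jacquetGL F (![0, 0, 1] : Fin 3 → Fin 2) (parabolicIndGL F (![0, 0, 1] : Fin 3 → Fin 2) σ)).IsIrreducible :=
    K2E3GL3CuspidalBlockJacquetSame.isIrreducible_jacquetGL_twoOne _ hσ's htriv hW hirr
  have hB : Subsingleton (restrictUnipotentGL F (id : Fin 3 → Fin 3) (parabolicIndGL F (![0, 0, 1] : Fin 3 → Fin 2) σ)).Coinvariants :=
    K2E3GL3CuspidalBlockJacquetBorel.subsingleton_coinvariants_restrictUnipotentGL_id _ hσ's hW hW₀₁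
  -- Casselman: `π` has no supercuspidal subquotient
  have hproper : IsProperBlocks (![0, 0, 1] : Fin 3 → Fin 2) :=
    ⟨fun a => by fin_cases a <;> [exact ⟨0, rfl⟩; exact ⟨2, rfl⟩], inferInstance⟩
  have hcusp : ∀ (N₀ : Subrepresentation (parabolicIndGL F (![0, 0, 1] : Fin 3 → Fin 2) σ)) (Y : Type u) [AddCommGroup Y] [Module ℂ Y]
      (τ : Representation ℂ (GL (Fin 3) F) Y) [τ.IsIrreducible], τ.IsAdmissible → τ.IsSupercuspidal → ∀ q : N₀.toRepresentation.IntertwiningMap τ, q = 0 :=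
    fun N₀ Y _ _ τ _ hτa hτc q => intertwiningMap_subrepresentation_parabolicIndGL_eq_zero_of_isIrreducible monotone_twoOne hproper hadm hτa hτc N₀ q
  -- a strict inclusion of subrepresentations is seen by one of the two MAXIMAL Jacquet images (the Borel one is `0`)
  have hΦ : ∀ {r : ℕ} (c : Fin 3 → Fin r), IsProperBlocks c → Monotone c →
      ∀ {N N' : Subrepresentation (parabolicIndGL F (![0, 0, 1] : Fin 3 → Fin 2) σ)}, jacquetImage c _ N < jacquetImage c _ N' →
        jacquetImage (![0, 0, 1] : Fin 3 → Fin 2) (parabolicIndGL F (![0, 0, 1] : Fin 3 → Fin 2) σ) N <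
            jacquetImage (![0, 0, 1] : Fin 3 → Fin 2) (parabolicIndGL F (![0, 0, 1] : Fin 3 → Fin 2) σ) N' ∨
          jacquetImage (![0, 1, 1] : Fin 3 → Fin 2) (parabolicIndGL F (![0, 0, 1] : Fin 3 → Fin 2) σ) N <
            jacquetImage (![0, 1, 1] : Fin 3 → Fin 2) (parabolicIndGL F (![0, 0, 1] : Fin 3 → Fin 2) σ) N' := by
    intro r c hp hm N N' hlt
    have hr2 : 1 < r := by simpa only [Fintype.card_fin] using Fintype.one_lt_card_iff_nontrivial.2 hp.2
    have hr3 : r ≤ 3 := by simpa only [Fintype.card_fin] using Fintype.card_le_of_surjective c hp.1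
    interval_cases r
    · rcases eq_twoOne_or_eq_oneTwo c hm hp.1 with rfl | rfl
      · exact Or.inl hlt
      · exact Or.inr hlt
    · exfalso
      obtain rfl := K2E3TwoBlockCuspidalSupportEmbedding.eq_id_of_monotone_surjective hm hp.1
      rw [jacquetImage_eq_bot_of_subsingleton _ hB N, jacquetImage_eq_bot_of_subsingleton _ hB N'] at hlt
      exact lt_irrefl _ hlt
  have simple₀ : ∀ N, jacquetImage (![0, 0, 1] : Fin 3 → Fin 2) (parabolicIndGL F (![0, 0, 1] : Fin 3 → Fin 2) σ) N = ⊥ ∨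
      jacquetImage (![0, 0, 1] : Fin 3 → Fin 2) (parabolicIndGL F (![0, 0, 1] : Fin 3 → Fin 2) σ) N = ⊤ := fun N => by
    haveI := hJ₀; exact IsSimpleOrder.eq_bot_or_eq_top _
  have simple₁ : ∀ N, jacquetImage (![0, 1, 1] : Fin 3 → Fin 2) (parabolicIndGL F (![0, 0, 1] : Fin 3 → Fin 2) σ) N = ⊥ ∨
      jacquetImage (![0, 1, 1] : Fin 3 → Fin 2) (parabolicIndGL F (![0, 0, 1] : Fin 3 → Fin 2) σ) N = ⊤ := fun N => by
    haveI := hJ₁; exact IsSimpleOrder.eq_bot_or_eq_top _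
  -- the lattice of subrepresentations of `π` is simple
  haveI : Nontrivial (Subrepresentation (parabolicIndGL F (![0, 0, 1] : Fin 3 → Fin 2) σ)) := by
    obtain ⟨w, hw⟩ := exists_ne (0 : W)
    obtain ⟨f, hf⟩ := K2E3GL3CuspidalBlockJacquetSame.exists_toFun_one_eq _ hσ's w
    refine ⟨⟨⊥, ⊤, fun h => hw ?_⟩⟩
    have hfbot : f ∈ (⊥ : Subrepresentation (parabolicIndGL F (![0, 0, 1] : Fin 3 → Fin 2) σ)) := by rw [h]; trivial
    have hf0 : f = 0 := (Submodule.mem_bot ℂ).1 hfbot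
    rw [← hf, hf0]
    rfl
  refine { eq_bot_or_eq_top := fun V => ?_ }
  by_contra hV
  push Not at hV
  obtain ⟨hVb, hVt⟩ := hV
  have hbot : ⊥ < V := bot_lt_iff_ne_bot.2 hVb
  have htop : V < ⊤ := lt_top_iff_ne_top.2 hVt
  -- the two layers `V ↪ π ↠ π ∕ V` and GEN-COUNT
  have hsmV : V.toRepresentation.IsSmooth := hπs.toRepresentation V
  have hsmQ : V.quotientRep.IsSmooth := hπs.quotientRep V
  haveI : Nontrivial V.toSubmodule := by
    obtain ⟨v, hv, hv0⟩ := (Submodule.ne_bot_iff V.toSubmodule).1 (fun h => hVb (Subrepresentation.toSubmodule_injective h))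
    exact ⟨⟨⟨v, hv⟩, 0, fun h => hv0 (congrArg Subtype.val h)⟩⟩
  haveI : Nontrivial (_ ⧸ V.toSubmodule) := by
    obtain ⟨v, hv⟩ : ∃ v, v ∉ V := by
      by_contra hall
      push Not at hall
      exact hVt (eq_top_iff.2 fun v _ => hall v)
    exact ⟨⟨V.mkQ v, 0, fun h => hv ((V.mkQ_eq_zero_iff v).1 h)⟩⟩
  have hgen : ¬ (IsGeneric V.toRepresentation ψ ∧ IsGeneric V.quotientRep ψ) := fun hh =>
    K2E3GenericConstituentCount.two_layers_not_generic_of_rank_le_one ψ hπs hψ.1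
      (Literature.RepresentationTheory.FiniteGroups.Subrepresentation.subtypeIntertwiningMap V)
      (Literature.RepresentationTheory.Semisimple.Subrepresentation.subtypeIntertwiningMap_injective V)
      V.mkQ V.mkQ_surjective (fun v => (V.mkQ_eq_zero_iff _).2 v.2) hrank hh.1 hh.2
  -- `Φ_c ⊥ < Φ_c V` for one maximal `c`, `Φ_{c'} V < Φ_{c'} ⊤` for one maximal `c'`
  obtain ⟨r, c, hp, hm, hlt⟩ := exists_jacquetImage_lt hπs hcusp hbot
  obtain ⟨r', c', hp', hm', hlt'⟩ := exists_jacquetImage_lt hπs hcusp htop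
  rcases hΦ c hp hm hlt with h₁ | h₁ <;> rcases hΦ c' hp' hm' hlt' with h₂ | h₂
  · -- `c = c' = c₀`: `Φ₀ ⊥ < Φ₀ V < Φ₀ ⊤` is impossible in the simple lattice `r_Q(π)`
    rcases simple₀ V with h | h
    · exact not_lt_bot (h₁.trans_eq h)
    · exact not_top_lt (h.symm.trans_lt h₂)
  · -- `Φ₀ V = ⊤`, `Φ₁ V = ⊥`
    have h0 : jacquetImage (![0, 0, 1] : Fin 3 → Fin 2) _ V = ⊤ := (simple₀ V).resolve_left fun h => not_lt_bot (h₁.trans_eq h)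
    have h1 : jacquetImage (![0, 1, 1] : Fin 3 → Fin 2) _ V = ⊥ := (simple₁ V).resolve_right fun h => not_top_lt (h.symm.trans_lt h₂)
    by_cases hVg : IsGeneric V.toRepresentation ψ
    · exact false_of_not_isGeneric_of_ker_eq_top V.quotientRep hsmQ hψ (fun hq => hgen ⟨hVg, hq⟩)
        (Or.inl (ker_quotientRep_eq_top_of_jacquetImage_eq_top _ V h0))
    · exact false_of_not_isGeneric_of_ker_eq_top V.toRepresentation hsmV hψ hVg
        (Or.inr (ker_toRepresentation_eq_top_of_jacquetImage_eq_bot _ hπs monotone_oneTwo V h1))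
  · -- `Φ₁ V = ⊤`, `Φ₀ V = ⊥`
    have h1 : jacquetImage (![0, 1, 1] : Fin 3 → Fin 2) _ V = ⊤ := (simple₁ V).resolve_left fun h => not_lt_bot (h₁.trans_eq h)
    have h0 : jacquetImage (![0, 0, 1] : Fin 3 → Fin 2) _ V = ⊥ := (simple₀ V).resolve_right fun h => not_top_lt (h.symm.trans_lt h₂)
    by_cases hVg : IsGeneric V.toRepresentation ψ
    · exact false_of_not_isGeneric_of_ker_eq_top V.quotientRep hsmQ hψ (fun hq => hgen ⟨hVg, hq⟩)
        (Or.inr (ker_quotientRep_eq_top_of_jacquetImage_eq_top _ V h1))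
    · exact false_of_not_isGeneric_of_ker_eq_top V.toRepresentation hsmV hψ hVg
        (Or.inl (ker_toRepresentation_eq_top_of_jacquetImage_eq_bot _ hπs monotone_twoOne V h0))
  · -- `c = c' = c₁`
    rcases simple₁ V with h | h
    · exact not_lt_bot (h₁.trans_eq h)
    · exact not_top_lt (h.symm.trans_lt h₂)

end Assembly

end Summit.HodgeConjecture.HodgeConjecture.Cruxes.H413.K2E3GL3TwoBlockInducedIrreducibleCore

end
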